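import Mathlib
import Summits.Ventures.PercRepro2.Defs
import Summits.Ventures.PercRepro2.Harris
import Summits.Ventures.PercRepro2.CoinDefs
import Summits.Ventures.PercRepro2.CoinReverse
import Summits.Ventures.PercRepro2.CoinLsmCoreDefs
import Summits.Ventures.PercRepro2.CoinLsmCoreU
import Summits.Ventures.PercRepro2.CoinSquareCoreDefs
import Summits.Ventures.PercRepro2.CoinCyl5

/-!
# The directed two-route core with routes of length 2 and 1 (blind cell PercRepro2, night-2 g8;
proofs/NIGHT2-DARC.md §33)

`D21Core arcs s p r q a c₁ c₂ c₃ c₄ c₅`: the five single-arc coins `c₁ = s → p`, `c₂ = p → r`,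
`c₃ = s → q`, `c₄ = r → a`, `c₅ = q → a` are the ONLY coins with an arc into `{s, p, r, q, a}`.  The
core is closed in, reachability is `s ⇝ p ⟺ α`, `s ⇝ r ⟺ αβ`, `s ⇝ q ⟺ γ`, `s ⇝ a ⟺ αβδ ∨ γε`,
and the core levels are unions of the cylinders of the five coins (`prob_level`): the ten clusters
`∅, p, q, qa, pq, pr, pqa, pra, pqr, pqra` with `ν(∅) = (1−α)(1−γ)`, `ν(p) = α(1−β)(1−γ)`,
`ν(q) = (1−α)γ(1−ε)`, `ν(qa) = (1−α)γε`, `ν(pq) = α(1−β)γ(1−ε)`, `ν(pr) = αβ(1−γ)(1−δ)`,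
`ν(pqa) = α(1−β)γε`, `ν(pra) = αβ(1−γ)δ`, `ν(pqr) = αβγ(1−δ)(1−ε)`, `ν(pqra) = αβγ(δ + ε − δε)`,
the other six subsets having probability `0`.
-/

namespace Summit.Ventures.PercRepro2.Coin

open Classical

section D21CoreDefs

variable {V : Type*} {E : Type*} [DecidableEq V]

/-- The directed two-route core `s → p → r → a ← q ← s`: five single-arc coins and «no other coin
enters `{s, p, r, q, a}`». -/
structure D21Core (arcs : E → Finset (V × V)) (s p r q a : V) (c₁ c₂ c₃ c₄ c₅ : E) : Prop where
  arc₁ : arcs c₁ = {(s, p)}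
  arc₂ : arcs c₂ = {(p, r)}
  arc₃ : arcs c₃ = {(s, q)}
  arc₄ : arcs c₄ = {(r, a)}
  arc₅ : arcs c₅ = {(q, a)}
  core : ∀ e, ∀ xy ∈ arcs e, (xy.2 = s ∨ xy.2 = p ∨ xy.2 = r ∨ xy.2 = q ∨ xy.2 = a) →
    e = c₁ ∨ e = c₂ ∨ e = c₃ ∨ e = c₄ ∨ e = c₅
  sp : s ≠ p
  sr : s ≠ r
  sq : s ≠ q
  sa : s ≠ a
  pr : p ≠ r
  pq : p ≠ q
  pa : p ≠ a
  rq : r ≠ q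
  ra : r ≠ a
  qa : q ≠ a

variable {arcs : E → Finset (V × V)} {s p r q a : V} {c₁ c₂ c₃ c₄ c₅ : E}

/-- The core is closed in. -/
theorem D21Core.closedInCoreU (h : D21Core arcs s p r q a c₁ c₂ c₃ c₄ c₅) :
    ClosedInCoreU arcs s {p, r, q, a} := by
  refine ⟨?_, ?_, ?_⟩
  · intro e xy hxy hy
    simp only [Finset.mem_insert, Finset.mem_singleton] at hy
    have hc := h.core e xy hxy (by tauto)
    simp only [Finset.mem_insert, Finset.mem_singleton]
    rcases hc with rfl | rfl | rfl | rfl | rfl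
    · rw [h.arc₁, Finset.mem_singleton] at hxy; subst hxy; simp
    · rw [h.arc₂, Finset.mem_singleton] at hxy; subst hxy; simp
    · rw [h.arc₃, Finset.mem_singleton] at hxy; subst hxy; simp
    · rw [h.arc₄, Finset.mem_singleton] at hxy; subst hxy; simp
    · rw [h.arc₅, Finset.mem_singleton] at hxy; subst hxy; simp
  · intro e xy hxy hy
    have hc := h.core e xy hxy (Or.inl hy)
    exfalso
    rcases hc with rfl | rfl | rfl | rfl | rfl
    · rw [h.arc₁, Finset.mem_singleton] at hxy; subst hxy; exact h.sp hy.symm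
    · rw [h.arc₂, Finset.mem_singleton] at hxy; subst hxy; exact h.sr hy.symm
    · rw [h.arc₃, Finset.mem_singleton] at hxy; subst hxy; exact h.sq hy.symm
    · rw [h.arc₄, Finset.mem_singleton] at hxy; subst hxy; exact h.sa hy.symm
    · rw [h.arc₅, Finset.mem_singleton] at hxy; subst hxy; exact h.sa hy.symm
  · simp only [Finset.mem_insert, Finset.mem_singleton, not_or]
    exact ⟨h.sp, h.sr, h.sq, h.sa⟩

omit [DecidableEq V] in
/-- The closure lemma: if `Z ⊆ {p, r, q, a}` and no OPEN coin carries an arc from outside `Z` into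
`Z`, nothing reachable from `s` lies in `Z`. -/
lemma D21Core.not_reach_of_closed (h : D21Core arcs s p r q a c₁ c₂ c₃ c₄ c₅) {ω : Config E}
    {Z : Set V} (hZs : s ∉ Z) (hZ : ∀ v ∈ Z, v = p ∨ v = r ∨ v = q ∨ v = a)
    (h₁ : ω c₁ = true → p ∈ Z → s ∈ Z) (h₂ : ω c₂ = true → r ∈ Z → p ∈ Z)
    (h₃ : ω c₃ = true → q ∈ Z → s ∈ Z) (h₄ : ω c₄ = true → a ∈ Z → r ∈ Z)
    (h₅ : ω c₅ = true → a ∈ Z → q ∈ Z)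
    {y : V} (hy : y ∈ Z) : ¬ Reach arcs ω s y := by
  intro hr
  have key := reach_mem_of_closed (U := Zᶜ) ?_ hZs hr
  · exact key hy
  · intro e he xy hxy hx hy'
    have hc := h.core e xy hxy (by rcases hZ _ hy' with h' | h' | h' | h' <;> simp [h'])
    rcases hc with rfl | rfl | rfl | rfl | rfl
    · rw [h.arc₁, Finset.mem_singleton] at hxy; subst hxy; exact hx (h₁ he hy')
    · rw [h.arc₂, Finset.mem_singleton] at hxy; subst hxy; exact hx (h₂ he hy')
    · rw [h.arc₃, Finset.mem_singleton] at hxy; subst hxy; exact hx (h₃ he hy')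
    · rw [h.arc₄, Finset.mem_singleton] at hxy; subst hxy; exact hx (h₄ he hy')
    · rw [h.arc₅, Finset.mem_singleton] at hxy; subst hxy; exact hx (h₅ he hy')

omit [DecidableEq V] in
/-- `s ⇝ p` iff `α` is open. -/
theorem D21Core.reach_p_iff (h : D21Core arcs s p r q a c₁ c₂ c₃ c₄ c₅) (ω : Config E) :
    Reach arcs ω s p ↔ ω c₁ = true := by
  constructor
  · intro hr
    by_cases hb1 : ω c₁ = true
    · exact hb1
    simp only [Bool.not_eq_true] at hb1
    exfalso
    refine h.not_reach_of_closed (Z := {v | v = p}) (by simp [h.sp]) (by simp) ?_ ?_ ?_ ?_ ?_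
      (by simp) hr
    · intro h'; simp [hb1] at h'
    · intro _ h'; simp [h.pr.symm] at h'
    · intro _ h'; simp [h.pq.symm] at h'
    · intro _ h'; simp [h.pa.symm] at h'
    · intro _ h'; simp [h.pa.symm] at h'
  · intro h1
    exact reach_of_openArc ⟨c₁, h1, by rw [h.arc₁]; simp⟩

omit [DecidableEq V] in
/-- `s ⇝ r` iff `α` and `β` are open. -/
theorem D21Core.reach_r_iff (h : D21Core arcs s p r q a c₁ c₂ c₃ c₄ c₅) (ω : Config E) :
    Reach arcs ω s r ↔ ω c₁ = true ∧ ω c₂ = true := by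
  constructor
  · intro hr
    by_cases hb1 : ω c₁ = true
    · by_cases hb2 : ω c₂ = true
      · exact ⟨hb1, hb2⟩
      simp only [Bool.not_eq_true] at hb2
      exfalso
      refine h.not_reach_of_closed (Z := {v | v = r}) (by simp [h.sr]) (by simp) ?_ ?_ ?_ ?_ ?_
        (by simp) hr
      · intro _ h'; simp [h.pr] at h'
      · intro h'; simp [hb2] at h'
      · intro _ h'; simp [h.rq.symm] at h'
      · intro _ h'; simp [h.ra.symm] at h'
      · intro _ h'; simp [h.ra.symm] at h'
    · simp only [Bool.not_eq_true] at hb1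
      exfalso
      refine h.not_reach_of_closed (Z := {v | v = p ∨ v = r}) (by simp [h.sp, h.sr]) (by simp)
        ?_ ?_ ?_ ?_ ?_ (by simp) hr
      · intro h'; simp [hb1] at h'
      · intro _ _; simp
      · intro _ h'; simp [h.pq.symm, h.rq.symm] at h'
      · intro _ h'; simp [h.pa.symm, h.ra.symm] at h'
      · intro _ h'; simp [h.pa.symm, h.ra.symm] at h'
  · rintro ⟨h1, h2⟩
    have r1 : Reach arcs ω s p := reach_of_openArc ⟨c₁, h1, by rw [h.arc₁]; simp⟩
    have r2 : Reach arcs ω p r := reach_of_openArc ⟨c₂, h2, by rw [h.arc₂]; simp⟩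
    exact reach_trans r1 r2

omit [DecidableEq V] in
/-- `s ⇝ q` iff `γ` is open. -/
theorem D21Core.reach_q_iff (h : D21Core arcs s p r q a c₁ c₂ c₃ c₄ c₅) (ω : Config E) :
    Reach arcs ω s q ↔ ω c₃ = true := by
  constructor
  · intro hr
    by_cases hb3 : ω c₃ = true
    · exact hb3
    simp only [Bool.not_eq_true] at hb3
    exfalso
    refine h.not_reach_of_closed (Z := {v | v = q}) (by simp [h.sq]) (by simp) ?_ ?_ ?_ ?_ ?_
      (by simp) hr
    · intro _ h'; simp [h.pq] at h'
    · intro _ h'; simp [h.rq] at h'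
    · intro h'; simp [hb3] at h'
    · intro _ h'; simp [h.qa.symm] at h'
    · intro _ h'; simp [h.qa.symm] at h'
  · intro h3
    exact reach_of_openArc ⟨c₃, h3, by rw [h.arc₃]; simp⟩

omit [DecidableEq V] in
/-- `s ⇝ a` iff the route `α, β, δ` or the route `γ, ε` is open. -/
theorem D21Core.reach_a_iff (h : D21Core arcs s p r q a c₁ c₂ c₃ c₄ c₅) (ω : Config E) :
    Reach arcs ω s a ↔ (ω c₁ = true ∧ ω c₂ = true ∧ ω c₄ = true) ∨ (ω c₃ = true ∧ ω c₅ = true) := by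
  constructor
  · intro hr
    by_cases hR1 : ω c₁ = true ∧ ω c₂ = true ∧ ω c₄ = true
    · exact Or.inl hR1
    by_cases hR2 : ω c₃ = true ∧ ω c₅ = true
    · exact Or.inr hR2
    exfalso
    -- route 2 blocked: either `γ` closed (then `q` unreachable) or `γ` open and `ε` closed
    by_cases hb3 : ω c₃ = true
    · have hb5 : ω c₅ = false := by
        cases hc : ω c₅
        · rfl
        · exact absurd ⟨hb3, hc⟩ hR2
      -- route 1 blocked at `α`, `β` or `δ`
      by_cases hb1 : ω c₁ = true
      · by_cases hb2 : ω c₂ = true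
        · have hb4 : ω c₄ = false := by
            cases hc : ω c₄
            · rfl
            · exact absurd ⟨hb1, hb2, hc⟩ hR1
          refine h.not_reach_of_closed (Z := {v | v = a}) (by simp [h.sa]) (by simp) ?_ ?_ ?_ ?_ ?_
            (by simp) hr
          · intro _ h'; simp [h.pa] at h'
          · intro _ h'; simp [h.ra] at h'
          · intro _ h'; simp [h.qa] at h'
          · intro h'; simp [hb4] at h'
          · intro h'; simp [hb5] at h'
        · simp only [Bool.not_eq_true] at hb2
          refine h.not_reach_of_closed (Z := {v | v = r ∨ v = a}) (by simp [h.sr, h.sa]) (by simp)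
            ?_ ?_ ?_ ?_ ?_ (by simp) hr
          · intro _ h'; simp [h.pr, h.pa] at h'
          · intro h'; simp [hb2] at h'
          · intro _ h'; simp [h.rq.symm, h.qa] at h'
          · intro _ _; simp
          · intro h'; simp [hb5] at h'
      · simp only [Bool.not_eq_true] at hb1
        refine h.not_reach_of_closed (Z := {v | v = p ∨ v = r ∨ v = a}) (by simp [h.sp, h.sr, h.sa])
          (by simp) ?_ ?_ ?_ ?_ ?_ (by simp) hr
        · intro h'; simp [hb1] at h'
        · intro _ _; simp
        · intro _ h'; simp [h.pq.symm, h.rq.symm, h.qa] at h'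
        · intro _ _; simp
        · intro h'; simp [hb5] at h'
    · simp only [Bool.not_eq_true] at hb3
      by_cases hb1 : ω c₁ = true
      · by_cases hb2 : ω c₂ = true
        · have hb4 : ω c₄ = false := by
            cases hc : ω c₄
            · rfl
            · exact absurd ⟨hb1, hb2, hc⟩ hR1
          refine h.not_reach_of_closed (Z := {v | v = q ∨ v = a}) (by simp [h.sq, h.sa]) (by simp)
            ?_ ?_ ?_ ?_ ?_ (by simp) hr
          · intro _ h'; simp [h.pq, h.pa] at h'
          · intro _ h'; simp [h.rq, h.ra] at h'
          · intro h'; simp [hb3] at h'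
          · intro h'; simp [hb4] at h'
          · intro _ _; simp
        · simp only [Bool.not_eq_true] at hb2
          refine h.not_reach_of_closed (Z := {v | v = r ∨ v = q ∨ v = a})
            (by simp [h.sr, h.sq, h.sa]) (by simp) ?_ ?_ ?_ ?_ ?_ (by simp) hr
          · intro _ h'; simp [h.pr, h.pq, h.pa] at h'
          · intro h'; simp [hb2] at h'
          · intro h'; simp [hb3] at h'
          · intro _ _; simp
          · intro _ _; simp
      · simp only [Bool.not_eq_true] at hb1
        refine h.not_reach_of_closed (Z := {v | v = p ∨ v = r ∨ v = q ∨ v = a})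
          (by simp [h.sp, h.sr, h.sq, h.sa]) (by simp) ?_ ?_ ?_ ?_ ?_ (by simp) hr
        · intro h'; simp [hb1] at h'
        · intro _ _; simp
        · intro h'; simp [hb3] at h'
        · intro _ _; simp
        · intro _ _; simp
  · rintro (⟨h1, h2, h4⟩ | ⟨h3, h5⟩)
    · have r1 : Reach arcs ω s p := reach_of_openArc ⟨c₁, h1, by rw [h.arc₁]; simp⟩
      have r2 : Reach arcs ω p r := reach_of_openArc ⟨c₂, h2, by rw [h.arc₂]; simp⟩
      have r3 : Reach arcs ω r a := reach_of_openArc ⟨c₄, h4, by rw [h.arc₄]; simp⟩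
      exact reach_trans r1 (reach_trans r2 r3)
    · have r1 : Reach arcs ω s q := reach_of_openArc ⟨c₃, h3, by rw [h.arc₃]; simp⟩
      have r2 : Reach arcs ω q a := reach_of_openArc ⟨c₅, h5, by rw [h.arc₅]; simp⟩
      exact reach_trans r1 r2

end D21CoreDefs

end Summit.Ventures.PercRepro2.Coin
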